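/-
Copyright (c) 2026 the pub-hodgecm-mathlib formalisation cell (harness21).  Prover seat hodgecm-mathlib-LH4-p13 (g2), req620 Track A «(D-RAM) FOUR-FRAME» squad
(heir LEAD F0P3a-plan lineage; dealer LH4-plan lineage; MS ROAD A, Stage B brick B4 «SPLIT STRATA» of SPEC `F0/P3c/LH4/LH4-p10/g2/SPEC-StageB.v1.LH4p10g2.md` §C,
FILE 3 of the brick: AXIS 1).  2026-09-04.
-/
import Summits.HodgeConjecture.HodgeConjecture.Theorems.F0P3cDyRamDiagonalStratumTools       -- B4 FILE 1 (this seat): orbit-invariance of the weight, coordinate-congruence indices, parity, Gram blocks; brings ★ TorusDefs, ★ B1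
import Summits.HodgeConjecture.HodgeConjecture.Theorems.F0P3cDyRamDiagonalUnitTorusOrbit     -- ★ (O1) p855595 (LH4-p09): `ncard_unitTorus_orbit_eq_relIndex_unitStabilizer`
import Summits.HodgeConjecture.HodgeConjecture.Theorems.F0P3cDyRamDiagonalStableLatticeHNF  -- ★ p855280 (LH4-p08): `mem_latt_hnf_iff`, `normalised_latt_hnf_iff`
import Summits.HodgeConjecture.HodgeConjecture.Theorems.F0P3cDyRamDiagonalHNFStability      -- ★ p855216 (LH4-p14): `mapGL_latt_hnf_eq_iff`
import Summits.HodgeConjecture.HodgeConjecture.Theorems.F0P3cDyRamDiagonalCoreUnique         -- ★ p855200 (LH4-p04): `isIntMatrix_diagonal_of_v_le`, `isIntMatrix_diagonal_inv_of_v_eq_one`, `v_det_diagonal_eq_one`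
import Summits.HodgeConjecture.HodgeConjecture.Theorems.F0P3cDyRamDiagonalGluedTubeCriterion -- ★ B5 (i) p855737 (LH4-p10): `formCongr_hnf_diagonal` (the Gram matrix of the HNF frame)
import HarnessLib

/-!
# Crux `H413`, MS ROAD A, STAGE B brick B4 «SPLIT STRATA», FILE 3: THE AXIS-1 ON-BRANCH STRATUM `T₁(s)` — `M₁(s,z) = latt (1 0 0; 0 1 0; 0 z ϖ^s)`, dualisable iff `s` even,
# `T`-stable iff `s ≤ n₁`, a single unit-torus orbit of `(q−1)q^{s−1}` lattices of weight `1∕((q−1)q^{s∕2−1})` each: WEIGHTED COUNT `q^{s∕2}`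

Cell `hodgecm-mathlib` (D-0151), FLOOR 0, crux item H413 = `stmt-HodgeConjecture-24833`, route of record `HCCMUnconditional`; squad F0∕P3c∕LH4 (req618∕req620).  THEOREMS ONLY
(no `def`, no instance, no notation, no `sorry`, default heartbeats); lane `--supports stmt-HodgeConjecture-24833 --as helper` (count-neutral).  Road target: tree
`Cruxes/H413/Lines/F0_P3c_DyRamFourFrame_U3_Laws.lean` stub `stub_U3_stableModelSum` (MS); paper proof = LH4-p10 (g2) MEMO-stableLaw-finite v2 §3–§4; Lean cut = SPEC-StageB v1.
THIS FILE = the FILE 2 (`F0P3cDyRamDiagonalSplitCount`, axis 3) template run for the stratum `T₁(s)` of MEMO §3.1 (`b = 0, c = s, x = y = 0, |z| = 1`; the plane `⟨e₁,e₂⟩`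
at distance `s` from the splitting sub-building, `e₀` split off; depth letter `n₁ = v(β − γ)` of `T = diag(α, β, γ)`, i.e. `v(β − 1)` for B10's `γ = 1`); axis 2 is FILE 4.

WHAT IS PROVED (generic valued field `K`; datum letters as in ★ B1; `q = Nat.card 𝓀[K]`).  §1 `M₁(s,z)` (`z` a unit) is dualisable for even `s` (form `diag(1, −zσz·π₀^{−j}, π₀^{−j})`,
`π₀ = ϖσϖ`; Gram block `(1 0 0; 0 0 a; 0 b c)` of FILE 1 §5) and only for even `s` (FILE 1 §4 at the axis `𝔭^s e₂`), normalised, `diag(u)`-stable iff `|u₂ − u₁| ≤ |ϖ^s|`, stabilisers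
`{u : u₂ ≡ u₁ (𝔭^s)}`, orbit `diag(u)·M₁(s,z) = M₁(s, u₂zu₁⁻¹)`.  §2 indices∕weight (FILE 1 §3) and the stratum `𝒮₁(s) := {M ∈ 𝓛₀(T) | dualisable, M = M₁(s,z), |z| = 1}`
EXHAUSTIVELY: `= 𝒯·M₁(s,1)` if `2 ∣ s ∧ s ≤ n₁`, `= ∅` if `n₁ < s` or `s` odd; `ncard = (q−1)q^{s−1}` (★ (O1)); HEAD **`finsum_stabiliserWeight_axis1Stratum`: `= q^{s∕2}`** (`2 ∣ s`, `2 ≤ s ≤ n₁`).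
HONEST LABEL.  Count-neutral (`--supports`); nothing printed is asserted; (MS) and the census laws stay PROVER TARGETS until B3∕B5–B7∕B9∕B10 land; `HC_CM` is proved only modulo the
7 printed citations (2 remaining named inputs: hLiu418 = `stmt-HodgeConjecture-24832`, h413 = `stmt-HodgeConjecture-24833`) until rung 0 closes.

## References
* [Kottwitz1986BaseChangeUnits] R. E. Kottwitz, *Base change for unit elements of Hecke algebras*, Compositio Math. 60 (1986), §1 pp. 240–241.
* [Rogawski1990] J. D. Rogawski, *Automorphic Representations of Unitary Groups in Three Variables*, Ann. of Math. Stud. 123 (1990), §4.9 Prop. 4.9.1 (a) p. 55.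
* [Serre1980Trees] J.-P. Serre, *Trees*, Springer (1980), Ch. II §1.1 (lattices, Hermite normal form, the diagonal action).
* [Jacobowitz1962] R. Jacobowitz, *Hermitian forms over local fields*, Amer. J. Math. 84 (1962), §4, §7 (Gram matrices, unimodular lattices).
-/

set_option autoImplicit false

noncomputable section

namespace Summit.HodgeConjecture.HodgeConjecture.Cruxes.H413.F0P3cDyRamDiagonalSplitCountAxisOne

open Matrix
open Literature.NumberTheory.Automorphic Literature.NumberTheory.Automorphic.HermitianLattice
open Literature.NumberTheory.Automorphic.UnitaryLatticeTree
open Summit.HodgeConjecture.HodgeConjecture.Cruxes.H413.F0P3cDyRamDiagonalTorusDefs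
open Summit.HodgeConjecture.HodgeConjecture.Cruxes.H413.F0P3cDyRamDiagonalStableLatticeHNF (mem_latt_hnf_iff normalised_latt_hnf_iff)
open Summit.HodgeConjecture.HodgeConjecture.Cruxes.H413.F0P3cDyRamDiagonalStratumTools
open Summit.HodgeConjecture.HodgeConjecture.Cruxes.H413.F0P3cDyRamDiagonalGluedTubeCriterion (formCongr_hnf_diagonal)
open Summit.HodgeConjecture.HodgeConjecture.Cruxes.H413.F0P3cDyRamDiagonalHNFStability (mapGL_latt_hnf_eq_iff)
open Summit.HodgeConjecture.HodgeConjecture.Cruxes.H413.F0P3cDyRamDiagonalCoreUnique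
open Summit.HodgeConjecture.HodgeConjecture.Cruxes.H413.F0P3cDyRamDiagonalUnitTorusOrbit
open scoped Valued WithZero Matrix MatrixGroups

variable {K : Type*} [Field K]

/-! ## §1  AXIS 1 — `M₁(s,z) = latt (1 0 0; 0 1 0; 0 z ϖ^s)` (the plane `⟨e₁,e₂⟩` at distance `s`, `e₀` split off; depth letter `|β − γ|` of `T = diag(α,β,γ)`) -/

section Valued

variable [Valued K ℤᵐ⁰]

omit [Valued K ℤᵐ⁰] in
/-- `det (1 0 0; 0 1 0; 0 z ϖ^s) = ϖ^s ≠ 0`. [cite: Serre1980Trees, II §1.1] -/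
theorem det_axis1_ne_zero {ϖ : K} (hϖ0 : ϖ ≠ 0) (z : K) (s : ℕ) : (!![1, 0, 0; 0, 1, 0; 0, z, ϖ ^ s] : Matrix (Fin 3) (Fin 3) K).det ≠ 0 := by
  rw [Matrix.det_fin_three]; simp [pow_ne_zero _ hϖ0]

/-- **(T₁·a) EVEN DEPTH ⇒ DUALISABLE**: `M₁(s,z)` (`z` a unit, `s` even) is self-dual for the `σ`-fixed form `diag(1, −zσz·π₀^{−j}, π₀^{−j})`, `π₀ = ϖσϖ`, `s = 2j` (Gram block
`(1 0 0; 0 0 a; 0 b c)`). [cite: Jacobowitz1962, §4, §7] [cite: Rogawski1990, §4.9 Prop. 4.9.1 (a) p. 55] -/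
theorem isDualisableLattice_latt_axis1 {σ : K →+* K} (hσ : ∀ a, σ (σ a) = a) (hvσ : ∀ a, Valued.v (σ a) = Valued.v a)
    {ϖ : K} (hϖ : Valued.v ϖ = WithZero.exp (-1 : ℤ)) {z : K} (hz : Valued.v z = 1) {s : ℕ} (h2 : 2 ∣ s) :
    IsDualisableLattice σ ϖ (latt (!![1, 0, 0; 0, 1, 0; 0, z, ϖ ^ s] : Matrix (Fin 3) (Fin 3) K)) := by
  obtain ⟨j, rfl⟩ := h2
  have hϖ0 : ϖ ≠ 0 := fun h0 => by rw [h0, map_zero] at hϖ; exact WithZero.coe_ne_zero hϖ.symm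
  have hϖ1 : Valued.v ϖ ≤ 1 := by rw [hϖ, ← WithZero.exp_zero, WithZero.exp_le_exp]; norm_num
  have hσϖ0 : σ ϖ ≠ 0 := (map_ne_zero σ).2 hϖ0
  have hz0 : z ≠ 0 := fun h => by rw [h, map_zero] at hz; exact zero_ne_one hz
  set π₀ : K := ϖ * σ ϖ with hπ₀
  have hπ₀σ : σ π₀ = π₀ := by rw [hπ₀, map_mul, hσ, mul_comm]
  have hπ₀0 : π₀ ≠ 0 := mul_ne_zero hϖ0 hσϖ0
  set d₁ : K := (π₀ ^ j)⁻¹ with hd₁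
  have hd₁σ : σ d₁ = d₁ := by rw [hd₁, map_inv₀, map_pow, hπ₀σ]
  have hd₁0 : d₁ ≠ 0 := inv_ne_zero (pow_ne_zero _ hπ₀0)
  have hvϖ0 : Valued.v ϖ ≠ 0 := (Valuation.ne_zero_iff _).2 hϖ0
  have hvd₁p : Valued.v d₁ * Valued.v (ϖ ^ (2 * j)) = 1 := by
    rw [hd₁, map_inv₀, map_pow, hπ₀, map_mul, hvσ, ← sq, map_pow, ← pow_mul]
    exact inv_mul_cancel₀ (pow_ne_zero _ hvϖ0)
  refine ⟨![1, -(σ z * d₁ * z), d₁], ?_, ?_⟩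
  · intro i
    fin_cases i
    · exact ⟨map_one σ, one_ne_zero⟩
    · refine ⟨?_, ?_⟩
      · show σ (-(σ z * d₁ * z)) = -(σ z * d₁ * z)
        rw [map_neg, map_mul, map_mul, hσ, hd₁σ]; ring
      · show -(σ z * d₁ * z) ≠ 0
        exact neg_ne_zero.2 (mul_ne_zero (mul_ne_zero ((map_ne_zero σ).2 hz0) hd₁0) hz0)
    · exact ⟨hd₁σ, hd₁0⟩
  · have hG : formCongr σ (Matrix.GeneralLinearGroup.mkOfDetNeZero _ (det_axis1_ne_zero hϖ0 z (2 * j))) (Matrix.diagonal ![1, -(σ z * d₁ * z), d₁]) =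
        !![1, 0, 0; 0, 0, σ z * d₁ * ϖ ^ (2 * j); 0, σ (ϖ ^ (2 * j)) * d₁ * z, σ (ϖ ^ (2 * j)) * d₁ * ϖ ^ (2 * j)] := by
      rw [formCongr_hnf_diagonal σ _ 0 0 z 1 (ϖ ^ (2 * j)) _ rfl]
      ext i j
      fin_cases i <;> fin_cases j <;> simp
    refine isVertexLattice_zero_of_gram_eq_block₁ hϖ1 _ hG ?_ ?_ ?_ (map_one _)
    · rw [map_mul, map_mul, hvσ, hz, one_mul, hvd₁p]
    · rw [map_mul, map_mul, hvσ, hz, mul_one, mul_comm, hvd₁p]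
    · rw [map_mul, map_mul, hvσ, mul_comm (Valued.v (ϖ ^ (2 * j))) (Valued.v d₁), mul_assoc, mul_comm (Valued.v (ϖ ^ (2 * j))),
        ← mul_assoc, hvd₁p, one_mul, map_pow]
      exact pow_le_one' hϖ1 _

/-- **(T₁·b)** `M₁(s,z)` is normalised for a unit `z`. [cite: Serre1980Trees, II §1.1] -/
theorem isNormalisedLattice_latt_axis1 {ϖ : K} (hϖ1 : Valued.v ϖ ≤ 1) {z : K} (hz : Valued.v z = 1) (s : ℕ) :
    IsNormalisedLattice (latt (!![1, 0, 0; 0, 1, 0; 0, z, ϖ ^ s] : Matrix (Fin 3) (Fin 3) K)) :=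
  (normalised_latt_hnf_iff (x := 0) (y := 0) (p := 1) (by rw [map_zero]; exact zero_le) (by rw [map_zero]; exact zero_le) hz.le
    (by rw [map_one]) (by rw [map_pow]; exact pow_le_one' hϖ1 _)).2 ⟨Or.inl (map_one _), Or.inr (Or.inr hz)⟩

/-- **(T₁·c) STABILITY**: for a unit diagonal `T = diag(u)`, `T·M₁(s,z) = M₁(s,z) ↔ |u₂ − u₁| ≤ |ϖ^s|` (★ `mapGL_latt_hnf_eq_iff` at `b = 0, c = s, x = y = 0`: only (S1)).
[cite: Kottwitz1986BaseChangeUnits, §1 pp. 240–241] -/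
theorem mapGL_latt_axis1_eq_iff {ϖ : K} (hϖ0 : ϖ ≠ 0) (u : Fin 3 → K) (hu : ∀ i, Valued.v (u i) = 1) (T : GL (Fin 3) K)
    (hT : (T : Matrix (Fin 3) (Fin 3) K) = Matrix.diagonal u) {z : K} (hz : Valued.v z = 1) (s : ℕ) :
    mapGL T (latt (!![1, 0, 0; 0, 1, 0; 0, z, ϖ ^ s] : Matrix (Fin 3) (Fin 3) K)) = latt (!![1, 0, 0; 0, 1, 0; 0, z, ϖ ^ s] : Matrix (Fin 3) (Fin 3) K) ↔
      Valued.v (u 2 - u 1) ≤ Valued.v (ϖ ^ s) := by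
  have hV : ((Matrix.GeneralLinearGroup.mkOfDetNeZero _ (det_axis1_ne_zero hϖ0 z s) : GL (Fin 3) K) : Matrix (Fin 3) (Fin 3) K) =
      !![1, 0, 0; 0, ϖ ^ 0, 0; 0, z, ϖ ^ s] := by
    rw [pow_zero]; rfl
  have h := mapGL_latt_hnf_eq_iff hϖ0 u hu T hT _ hV
  rw [show latt (!![1, 0, 0; 0, 1, 0; 0, z, ϖ ^ s] : Matrix (Fin 3) (Fin 3) K) =
      latt ((Matrix.GeneralLinearGroup.mkOfDetNeZero _ (det_axis1_ne_zero hϖ0 z s) : GL (Fin 3) K) : Matrix (Fin 3) (Fin 3) K) from rfl, h]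
  simp only [mul_zero, zero_mul, zero_add, map_zero, zero_le, true_and, and_true]
  have hvs : 0 < Valued.v (ϖ ^ s) := (Valuation.pos_iff _).2 (pow_ne_zero _ hϖ0)
  rw [map_mul, map_mul, hz, mul_one, map_inv₀, mul_inv_le_iff₀ hvs, one_mul]

/-- (T₁·c′) For `T = diag(α, β, γ)`: `T·M₁(s,z) = M₁(s,z) ↔ |γ − β| ≤ |ϖ^s|`. [cite: Kottwitz1986BaseChangeUnits, §1 pp. 240–241] -/
theorem mapGL_latt_axis1_eq_iff_of_diagonal {ϖ : K} (hϖ0 : ϖ ≠ 0) {α β γ : K} (hα : Valued.v α = 1) (hβ : Valued.v β = 1) (hγ : Valued.v γ = 1)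
    (T : GL (Fin 3) K) (hT : (T : Matrix (Fin 3) (Fin 3) K) = Matrix.diagonal ![α, β, γ]) {z : K} (hz : Valued.v z = 1) (s : ℕ) :
    mapGL T (latt (!![1, 0, 0; 0, 1, 0; 0, z, ϖ ^ s] : Matrix (Fin 3) (Fin 3) K)) = latt (!![1, 0, 0; 0, 1, 0; 0, z, ϖ ^ s] : Matrix (Fin 3) (Fin 3) K) ↔
      Valued.v (γ - β) ≤ Valued.v (ϖ ^ s) := by
  have hu : ∀ i, Valued.v ((![α, β, γ] : Fin 3 → K) i) = 1 := by intro i; fin_cases i <;> assumption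
  exact mapGL_latt_axis1_eq_iff hϖ0 ![α, β, γ] hu T hT hz s

/-- **(T₁·d)** `diag(u)·M₁(s,z) = M₁(s,z) ↔ |u₂ − u₁| ≤ |ϖ^s|` for unit vectors `u`. [cite: Kottwitz1986BaseChangeUnits, §1 pp. 240–241] -/
theorem mem_latticeStabilizer_latt_axis1_iff {ϖ : K} (hϖ0 : ϖ ≠ 0) {z : K} (hz : Valued.v z = 1) (s : ℕ) {u : Fin 3 → Kˣ}
    (hu : ∀ i, Valued.v (u i : K) = 1) :
    u ∈ latticeStabilizer (latt (!![1, 0, 0; 0, 1, 0; 0, z, ϖ ^ s] : Matrix (Fin 3) (Fin 3) K)) ↔ Valued.v ((u 2 : K) - u 1) ≤ Valued.v (ϖ ^ s) := by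
  rw [mem_latticeStabilizer_iff]
  exact mapGL_latt_axis1_eq_iff hϖ0 (fun i => (u i : K)) hu (diagGLUnits u) (coe_diagGLUnits u) hz s

/-- `S̃(M₁(s,z)) = {u ∈ 𝒯 : u₂ ≡ u₁ (𝔭^s)}`. [cite: Kottwitz1986BaseChangeUnits, §1 pp. 240–241] -/
theorem mem_unitStabilizer_latt_axis1_iff {ϖ : K} (hϖ0 : ϖ ≠ 0) {z : K} (hz : Valued.v z = 1) (s : ℕ) (u : Fin 3 → Kˣ) :
    u ∈ unitStabilizer (latt (!![1, 0, 0; 0, 1, 0; 0, z, ϖ ^ s] : Matrix (Fin 3) (Fin 3) K)) ↔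
      u ∈ unitTorus K 3 ∧ Valued.v ((u 2 : K) - u 1) ≤ Valued.v (ϖ ^ s) := by
  rw [F0P3cDyRamDiagonalTorusDefs.unitStabilizer, Subgroup.mem_inf]
  exact ⟨fun ⟨h1, h2⟩ => ⟨h2, (mem_latticeStabilizer_latt_axis1_iff hϖ0 hz s ((mem_unitTorus_iff u).1 h2)).1 h1⟩,
    fun ⟨h2, h1⟩ => ⟨(mem_latticeStabilizer_latt_axis1_iff hϖ0 hz s ((mem_unitTorus_iff u).1 h2)).2 h1, h2⟩⟩

/-- `S_F(M₁(s,z)) = {u ∈ 𝒰 : u₂ ≡ u₁ (𝔭^s)}`. [cite: Rogawski1990, §4.9 Prop. 4.9.1 (a) p. 55] -/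
theorem mem_fixedUnitStabilizer_latt_axis1_iff (σ : K →+* K) {ϖ : K} (hϖ0 : ϖ ≠ 0) {z : K} (hz : Valued.v z = 1) (s : ℕ) (u : Fin 3 → Kˣ) :
    u ∈ fixedUnitStabilizer σ (latt (!![1, 0, 0; 0, 1, 0; 0, z, ϖ ^ s] : Matrix (Fin 3) (Fin 3) K)) ↔
      u ∈ fixedUnitTorus σ 3 ∧ Valued.v ((u 2 : K) - u 1) ≤ Valued.v (ϖ ^ s) := by
  rw [fixedUnitStabilizer, Subgroup.mem_inf]
  exact ⟨fun ⟨h1, h2⟩ => ⟨h2, (mem_latticeStabilizer_latt_axis1_iff hϖ0 hz s ((mem_fixedUnitTorus_iff σ u).1 h2).1).1 h1⟩,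
    fun ⟨h2, h1⟩ => ⟨(mem_latticeStabilizer_latt_axis1_iff hϖ0 hz s ((mem_fixedUnitTorus_iff σ u).1 h2).1).2 h1, h2⟩⟩

/-- **(T₁·e) ORBIT**: `diag(u)·M₁(s,z) = M₁(s, u₂zu₁⁻¹)` for `u ∈ 𝒯`. [cite: Kottwitz1986BaseChangeUnits, §1 pp. 240–241] [cite: Serre1980Trees, II §1.1] -/
theorem mapGL_diagGLUnits_latt_axis1 {ϖ : K} (hϖ0 : ϖ ≠ 0) {u : Fin 3 → Kˣ} (hu : u ∈ unitTorus K 3) (z : K) (s : ℕ) :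
    mapGL (diagGLUnits u) (latt (!![1, 0, 0; 0, 1, 0; 0, z, ϖ ^ s] : Matrix (Fin 3) (Fin 3) K)) =
      latt (!![1, 0, 0; 0, 1, 0; 0, (u 2 : K) * z * ((u 1 : K))⁻¹, ϖ ^ s] : Matrix (Fin 3) (Fin 3) K) := by
  have hu' := (mem_unitTorus_iff u).1 hu
  have hmat : (Matrix.diagonal fun i => (u i : K)) * (!![1, 0, 0; 0, 1, 0; 0, z, ϖ ^ s] : Matrix (Fin 3) (Fin 3) K) =
      !![1, 0, 0; 0, 1, 0; 0, (u 2 : K) * z * ((u 1 : K))⁻¹, ϖ ^ s] * Matrix.diagonal fun i => (u i : K) := by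
    have hdiag : (Matrix.diagonal fun i => (u i : K)) = !![((u 0 : Kˣ) : K), 0, 0; 0, ((u 1 : Kˣ) : K), 0; 0, 0, ((u 2 : Kˣ) : K)] := by
      ext i j; fin_cases i <;> fin_cases j <;> simp
    rw [hdiag]
    ext i j
    fin_cases i <;> fin_cases j <;> simp [Matrix.mul_apply, Fin.sum_univ_three]
    exact mul_comm _ _
  rw [mapGL, ← latt_mul, coe_diagGLUnits, hmat]
  exact latt_mul_eq_latt_of_isIntMatrix (isUnit_iff_ne_zero.2 (det_axis1_ne_zero hϖ0 _ s))
    (by rw [isUnit_iff_ne_zero, (Valuation.ne_zero_iff Valued.v).symm, v_det_diagonal_eq_one hu']; exact one_ne_zero)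
    (isIntMatrix_diagonal_of_v_le fun i => (hu' i).le) (isIntMatrix_diagonal_inv_of_v_eq_one hu')

/-- **(T₁·a′) DUALISABLE ⇒ EVEN DEPTH** (axis `M₁ ∩ Ke₂ = 𝔭^s e₂` at the normalised slot 2; FILE 1 §4). [cite: Jacobowitz1962, §7] [cite: Rogawski1990, §4.9 Prop. 4.9.1 (a) p. 55] -/
theorem two_dvd_of_isDualisableLattice_latt_axis1 {σ : K →+* K} (hvσ : ∀ a, Valued.v (σ a) = Valued.v a)
    (hfix : ∀ x : K, σ x = x → x ≠ 0 → ∃ n : ℤ, Valued.v x = WithZero.exp (2 * n)) {ϖ : K} (hϖ : Valued.v ϖ = WithZero.exp (-1 : ℤ))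
    {z : K} (hz : Valued.v z = 1) {s : ℕ} (hM : IsDualisableLattice σ ϖ (latt (!![1, 0, 0; 0, 1, 0; 0, z, ϖ ^ s] : Matrix (Fin 3) (Fin 3) K))) : 2 ∣ s := by
  have hϖ0 : ϖ ≠ 0 := fun h0 => by rw [h0, map_zero] at hϖ; exact WithZero.coe_ne_zero hϖ.symm
  have hϖ1 : Valued.v ϖ ≤ 1 := by rw [hϖ, ← WithZero.exp_zero, WithZero.exp_le_exp]; norm_num
  have hps : (ϖ ^ s : K) ≠ 0 := pow_ne_zero _ hϖ0
  have hmem : ∀ w : K, (Pi.single 2 w : Fin 3 → K) ∈ latt (!![1, 0, 0; 0, 1, 0; 0, z, ϖ ^ s] : Matrix (Fin 3) (Fin 3) K) ↔ Valued.v w ≤ Valued.v (ϖ ^ s) := by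
    intro w
    rw [show (!![1, 0, 0; 0, 1, 0; 0, z, ϖ ^ s] : Matrix (Fin 3) (Fin 3) K) = Matrix.of ![![1, 0, 0], ![0, 1, 0], ![0, z, ϖ ^ s]] from rfl,
      mem_latt_hnf_iff 0 0 z one_ne_zero hps]
    simp
  have hN := isNormalisedLattice_latt_axis1 hϖ1 hz s 2
  exact two_dvd_of_isDualisableLattice_of_axis hvσ hfix hϖ hM 2 ((hmem _).2 le_rfl) (fun w hw => (hmem w).1 hw) hN.1 hN.2

/-! ## §2  Axis 1: indices, weight, stratum, count -/

/-- `[𝒯 : S̃(M₁(s,z))] = (q − 1)·q^{s−1}` (`s ≥ 1`). [cite: Serre1979, Ch. IV §2 Prop. 6] [cite: Kottwitz1986BaseChangeUnits, §1 pp. 240–241] -/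
theorem relIndex_unitStabilizer_latt_axis1 {ϖ : K} (hϖ : Valued.v ϖ = WithZero.exp (-1 : ℤ)) [Finite 𝓀[K]] {z : K} (hz : Valued.v z = 1)
    {s : ℕ} (hs : 1 ≤ s) :
    (unitStabilizer (latt (!![1, 0, 0; 0, 1, 0; 0, z, ϖ ^ s] : Matrix (Fin 3) (Fin 3) K))).relIndex (unitTorus K 3) =
      (Nat.card 𝓀[K] - 1) * Nat.card 𝓀[K] ^ (s - 1) := by
  have hϖ0 : ϖ ≠ 0 := fun h0 => by rw [h0, map_zero] at hϖ; exact WithZero.coe_ne_zero hϖ.symm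
  exact relIndex_unitTorus_of_coordCongr hϖ (by decide) hs _ (mem_unitStabilizer_latt_axis1_iff hϖ0 hz s)

/-- **(T₁·f) WEIGHT**: `stabiliserWeight σ (M₁(s,z)) = 1 ∕ ((q−1)·q^{⌈s∕2⌉−1})` (`s ≥ 1`, `z` a unit). [cite: Rogawski1990, §4.9 Prop. 4.9.1 (a) p. 55] -/
theorem stabiliserWeight_latt_axis1 {σ : K →+* K} (hσ : ∀ a, σ (σ a) = a) (hvσ : ∀ a, Valued.v (σ a) = Valued.v a)
    (hfix : ∀ x : K, σ x = x → x ≠ 0 → ∃ n : ℤ, Valued.v x = WithZero.exp (2 * n)) {ϖ : K} (hϖ : Valued.v ϖ = WithZero.exp (-1 : ℤ))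
    {d : ℕ} (hd : Valued.v (ϖ - σ ϖ) = Valued.v ϖ ^ d) [Finite 𝓀[K]] {z : K} (hz : Valued.v z = 1) {s : ℕ} (hs : 1 ≤ s) :
    stabiliserWeight σ (latt (!![1, 0, 0; 0, 1, 0; 0, z, ϖ ^ s] : Matrix (Fin 3) (Fin 3) K)) =
      ((((Nat.card 𝓀[K] - 1) * Nat.card 𝓀[K] ^ ((s + 1) / 2 - 1) : ℕ) : ℚ))⁻¹ := by
  have hϖ0 : ϖ ≠ 0 := fun h0 => by rw [h0, map_zero] at hϖ; exact WithZero.coe_ne_zero hϖ.symm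
  rw [stabiliserWeight, relIndex_fixedUnitTorus_of_coordCongr hσ hvσ hfix hϖ hd (by decide) hs _ (mem_fixedUnitStabilizer_latt_axis1_iff σ hϖ0 hz s)]

/-- **(T₁·g) THE STRATUM IS A UNIT-TORUS ORBIT** (`2 ∣ s`, `s ≤ n₁`, `|β − γ| = |ϖ|^{n₁}`): `𝒮₁(s) = 𝒯·M₁(s,1)`. [cite: Kottwitz1986BaseChangeUnits, §1 pp. 240–241] -/
theorem axis1Stratum_eq_orbit {σ : K →+* K} (hσ : ∀ a, σ (σ a) = a) (hvσ : ∀ a, Valued.v (σ a) = Valued.v a)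
    {ϖ : K} (hϖ : Valued.v ϖ = WithZero.exp (-1 : ℤ)) (T : GL (Fin 3) K) {α β γ : K} (hT : (T : Matrix (Fin 3) (Fin 3) K) = Matrix.diagonal ![α, β, γ])
    (hα : Valued.v α = 1) (hβ : Valued.v β = 1) (hγ : Valued.v γ = 1) {n₁ : ℕ} (h₁ : Valued.v (β - γ) = Valued.v ϖ ^ n₁) {s : ℕ} (h2 : 2 ∣ s) (hn : s ≤ n₁) :
    {M : Submodule 𝒪[K] (Fin 3 → K) | M ∈ normalisedStableLattices T ∧ IsDualisableLattice σ ϖ M ∧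
        ∃ z : K, Valued.v z = 1 ∧ M = latt (!![1, 0, 0; 0, 1, 0; 0, z, ϖ ^ s] : Matrix (Fin 3) (Fin 3) K)} =
      {M | ∃ u ∈ unitTorus K 3, M = mapGL (diagGLUnits u) (latt (!![1, 0, 0; 0, 1, 0; 0, 1, ϖ ^ s] : Matrix (Fin 3) (Fin 3) K))} := by
  have hϖ0 : ϖ ≠ 0 := fun h0 => by rw [h0, map_zero] at hϖ; exact WithZero.coe_ne_zero hϖ.symm
  have hϖ1 : Valued.v ϖ ≤ 1 := by rw [hϖ, ← WithZero.exp_zero, WithZero.exp_le_exp]; norm_num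
  have hstab : Valued.v (γ - β) ≤ Valued.v (ϖ ^ s) := by
    rw [Valuation.map_sub_swap, h₁]; exact (v_pow_le_v_pow_iff hϖ s n₁).2 hn
  ext M
  simp only [Set.mem_setOf_eq]
  constructor
  · rintro ⟨-, -, z, hz, rfl⟩
    have hz0 : z ≠ 0 := fun h => by rw [h, map_zero] at hz; exact zero_ne_one hz
    have hu : (![1, 1, Units.mk0 z hz0] : Fin 3 → Kˣ) ∈ unitTorus K 3 := by
      rw [mem_unitTorus_iff]; intro i; fin_cases i <;> simp [hz]
    refine ⟨![1, 1, Units.mk0 z hz0], hu, ?_⟩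
    rw [mapGL_diagGLUnits_latt_axis1 hϖ0 hu 1 s]
    simp
  · rintro ⟨u, hu, rfl⟩
    rw [mapGL_diagGLUnits_latt_axis1 hϖ0 hu 1 s]
    have h1 := (mem_unitTorus_iff u).1 hu 1
    have h2' := (mem_unitTorus_iff u).1 hu 2
    have hz : Valued.v ((u 2 : K) * 1 * ((u 1 : K))⁻¹) = 1 := by rw [map_mul, map_mul, map_inv₀, h1, h2', map_one]; simp
    refine ⟨⟨⟨Matrix.GeneralLinearGroup.mkOfDetNeZero _ (det_axis1_ne_zero hϖ0 _ s), rfl⟩, ?_, isNormalisedLattice_latt_axis1 hϖ1 hz s⟩,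
      isDualisableLattice_latt_axis1 hσ hvσ hϖ hz h2, _, hz, rfl⟩
    exact (mapGL_latt_axis1_eq_iff_of_diagonal hϖ0 hα hβ hγ T hT hz s).2 hstab

/-- **(T₁·h) EMPTY ABOVE THE DEPTH** (`n₁ < s`). [cite: Kottwitz1986BaseChangeUnits, §1 pp. 240–241] -/
theorem axis1Stratum_eq_empty (σ : K →+* K) {ϖ : K} (hϖ : Valued.v ϖ = WithZero.exp (-1 : ℤ)) (T : GL (Fin 3) K) {α β γ : K}
    (hT : (T : Matrix (Fin 3) (Fin 3) K) = Matrix.diagonal ![α, β, γ]) (hα : Valued.v α = 1) (hβ : Valued.v β = 1) (hγ : Valued.v γ = 1) {n₁ : ℕ}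
    (h₁ : Valued.v (β - γ) = Valued.v ϖ ^ n₁) {s : ℕ} (hn : n₁ < s) :
    {M : Submodule 𝒪[K] (Fin 3 → K) | M ∈ normalisedStableLattices T ∧ IsDualisableLattice σ ϖ M ∧
        ∃ z : K, Valued.v z = 1 ∧ M = latt (!![1, 0, 0; 0, 1, 0; 0, z, ϖ ^ s] : Matrix (Fin 3) (Fin 3) K)} = ∅ := by
  have hϖ0 : ϖ ≠ 0 := fun h0 => by rw [h0, map_zero] at hϖ; exact WithZero.coe_ne_zero hϖ.symm
  refine Set.eq_empty_of_forall_notMem fun M ⟨⟨_, hTM, _⟩, _, z, hz, hM⟩ => ?_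
  have h := (mapGL_latt_axis1_eq_iff_of_diagonal hϖ0 hα hβ hγ T hT hz s).1 (hM ▸ hTM)
  rw [Valuation.map_sub_swap, h₁, v_pow_le_v_pow_iff hϖ] at h
  omega

/-- **(T₁·h′) EMPTY AT ODD DEPTH.** [cite: Jacobowitz1962, §7] [cite: Rogawski1990, §4.9 Prop. 4.9.1 (a) p. 55] -/
theorem axis1Stratum_eq_empty_of_not_two_dvd {σ : K →+* K} (hvσ : ∀ a, Valued.v (σ a) = Valued.v a)
    (hfix : ∀ x : K, σ x = x → x ≠ 0 → ∃ n : ℤ, Valued.v x = WithZero.exp (2 * n)) {ϖ : K} (hϖ : Valued.v ϖ = WithZero.exp (-1 : ℤ))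
    (T : GL (Fin 3) K) {s : ℕ} (hodd : ¬ 2 ∣ s) :
    {M : Submodule 𝒪[K] (Fin 3 → K) | M ∈ normalisedStableLattices T ∧ IsDualisableLattice σ ϖ M ∧
        ∃ z : K, Valued.v z = 1 ∧ M = latt (!![1, 0, 0; 0, 1, 0; 0, z, ϖ ^ s] : Matrix (Fin 3) (Fin 3) K)} = ∅ := by
  refine Set.eq_empty_of_forall_notMem fun M ⟨_, hD, z, hz, hM⟩ => ?_
  exact hodd (two_dvd_of_isDualisableLattice_latt_axis1 hvσ hfix hϖ hz (hM ▸ hD))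

/-- **(T₁·i) `#𝒮₁(s) = (q − 1)·q^{s−1}`** (`2 ∣ s`, `1 ≤ s ≤ n₁`). [cite: Kottwitz1986BaseChangeUnits, §1 pp. 240–241] [cite: Serre1979, Ch. IV §2 Prop. 6] -/
theorem ncard_axis1Stratum {σ : K →+* K} (hσ : ∀ a, σ (σ a) = a) (hvσ : ∀ a, Valued.v (σ a) = Valued.v a)
    {ϖ : K} (hϖ : Valued.v ϖ = WithZero.exp (-1 : ℤ)) [Finite 𝓀[K]] (T : GL (Fin 3) K) {α β γ : K}
    (hT : (T : Matrix (Fin 3) (Fin 3) K) = Matrix.diagonal ![α, β, γ]) (hα : Valued.v α = 1) (hβ : Valued.v β = 1) (hγ : Valued.v γ = 1) {n₁ : ℕ}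
    (h₁ : Valued.v (β - γ) = Valued.v ϖ ^ n₁) {s : ℕ} (h2 : 2 ∣ s) (hs : 1 ≤ s) (hn : s ≤ n₁) :
    {M : Submodule 𝒪[K] (Fin 3 → K) | M ∈ normalisedStableLattices T ∧ IsDualisableLattice σ ϖ M ∧
        ∃ z : K, Valued.v z = 1 ∧ M = latt (!![1, 0, 0; 0, 1, 0; 0, z, ϖ ^ s] : Matrix (Fin 3) (Fin 3) K)}.ncard =
      (Nat.card 𝓀[K] - 1) * Nat.card 𝓀[K] ^ (s - 1) := by
  rw [axis1Stratum_eq_orbit hσ hvσ hϖ T hT hα hβ hγ h₁ h2 hn, ncard_unitTorus_orbit_eq_relIndex_unitStabilizer,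
    relIndex_unitStabilizer_latt_axis1 hϖ (map_one _) hs]

/-- **(T₁) HEAD — THE WEIGHTED COUNT OF THE AXIS-1 STRATUM IS `q^{s∕2}`** (`2 ∣ s`, `2 ≤ s ≤ n₁`; MEMO v2 §4 (T), SPEC §C B4).
[cite: Rogawski1990, §4.9 Prop. 4.9.1 (a) p. 55] [cite: Kottwitz1986BaseChangeUnits, §1 pp. 240–241] -/
theorem finsum_stabiliserWeight_axis1Stratum {σ : K →+* K} (hσ : ∀ a, σ (σ a) = a) (hvσ : ∀ a, Valued.v (σ a) = Valued.v a)
    (hfix : ∀ x : K, σ x = x → x ≠ 0 → ∃ n : ℤ, Valued.v x = WithZero.exp (2 * n)) {ϖ : K} (hϖ : Valued.v ϖ = WithZero.exp (-1 : ℤ))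
    {d : ℕ} (hd : Valued.v (ϖ - σ ϖ) = Valued.v ϖ ^ d) [Finite 𝓀[K]] (T : GL (Fin 3) K) {α β γ : K}
    (hT : (T : Matrix (Fin 3) (Fin 3) K) = Matrix.diagonal ![α, β, γ]) (hα : Valued.v α = 1) (hβ : Valued.v β = 1) (hγ : Valued.v γ = 1) {n₁ : ℕ}
    (h₁ : Valued.v (β - γ) = Valued.v ϖ ^ n₁) {s : ℕ} (h2 : 2 ∣ s) (hs : 2 ≤ s) (hn : s ≤ n₁) :
    ∑ᶠ M ∈ {M : Submodule 𝒪[K] (Fin 3 → K) | M ∈ normalisedStableLattices T ∧ IsDualisableLattice σ ϖ M ∧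
        ∃ z : K, Valued.v z = 1 ∧ M = latt (!![1, 0, 0; 0, 1, 0; 0, z, ϖ ^ s] : Matrix (Fin 3) (Fin 3) K)}, stabiliserWeight σ M =
      (Nat.card 𝓀[K] : ℚ) ^ (s / 2) := by
  have hq : 1 < Nat.card 𝓀[K] := Finite.one_lt_card
  have hcard := ncard_axis1Stratum hσ hvσ hϖ T hT hα hβ hγ h₁ h2 (by omega) hn
  have hfin : {M : Submodule 𝒪[K] (Fin 3 → K) | M ∈ normalisedStableLattices T ∧ IsDualisableLattice σ ϖ M ∧
      ∃ z : K, Valued.v z = 1 ∧ M = latt (!![1, 0, 0; 0, 1, 0; 0, z, ϖ ^ s] : Matrix (Fin 3) (Fin 3) K)}.Finite := by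
    refine Set.finite_of_ncard_ne_zero ?_
    rw [hcard]
    exact mul_ne_zero (by omega) (pow_ne_zero _ (by omega))
  rw [finsum_mem_eq_ncard_mul hfin _ ((((Nat.card 𝓀[K] - 1) * Nat.card 𝓀[K] ^ ((s + 1) / 2 - 1) : ℕ) : ℚ))⁻¹ ?_, hcard]
  · obtain ⟨j, rfl⟩ := h2
    have e1 : (2 * j + 1) / 2 - 1 = j - 1 := by omega
    have e2 : 2 * j / 2 = j := by omega
    have e3 : 2 * j - 1 = j + (j - 1) := by omega
    rw [e1, e2, e3, pow_add]
    have hq1 : ((Nat.card 𝓀[K] - 1 : ℕ) : ℚ) ≠ 0 := by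
      rw [Nat.cast_ne_zero]; omega
    have hqj : ((Nat.card 𝓀[K] : ℚ)) ^ (j - 1) ≠ 0 := pow_ne_zero _ (by rw [Nat.cast_ne_zero]; omega)
    push_cast
    field_simp
  · intro M hM
    rw [axis1Stratum_eq_orbit hσ hvσ hϖ T hT hα hβ hγ h₁ ⟨s / 2, by omega⟩ hn] at hM
    obtain ⟨u, -, rfl⟩ := hM
    rw [stabiliserWeight_mapGL_diagGLUnits, stabiliserWeight_latt_axis1 hσ hvσ hfix hϖ hd (map_one _) (by omega)]

end Valued

end Summit.HodgeConjecture.HodgeConjecture.Cruxes.H413.F0P3cDyRamDiagonalSplitCountAxisOne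

end
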